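import Summits.QuantumFields.BalabanUV.Beta.RemainderCouplingHolomorphy

/-!
# EriceRemainderEnclosureHolomorphyNecessity — (E16) THE UNIFORM PAIR (ρ, M) OF (D4-J5) IS LOAD-BEARING, EACH HALF SEPARATELY:
# an ENTIRE Markov family whose last-variable sections satisfy [I]'s p. 264 clause in its PER-SCALE reading («smooth … (or
# analytic), uniformly bounded on this interval together with all derivatives» read per j — WEAKER than R-264's uniform-in-j reading
# of the same clause, `BetaDerivClause.LastVarDerivBound`, which fails here), extend holomorphically at EVERY scale
# with ONE sup bound but shrinking radii ρ_j = 1∕(j+1), AND with ONE radius but growing sup bounds M_j = r₀(1 + e^{(j+1)ρ}), and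
# whose printed split nevertheless has CONSUMED(b) ⟺ r₀ < b and NO junction — so neither R-264 nor R-266 = «R-264 (hol)» is
# entered, and no uniform (ρ, M), no uniform derivative constant C, exists for it

Cell `pub-balaban`, β-function sub-cell, BINDER row D4 «RemainderConst leaves for Bałaban's split» (`HOME/BINDER-OWNERS.md`; owner
lineage `b2b-balaban-beta-an4`; this file by co-owner #2 lineage `b2b-balaban-beta-d4-p2` (MODEL crew), generation 22), β-FLOW TEAM
duty (1) under the coordinator rulings «YM REDIRECT TOWARDS THE SUMMIT» (FREEZE (0) honoured: def-free module in the lineage's own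
`EriceRemainderEnclosure*` series; no leaf, no interface, no folklore-algebra module) and «YM ACCELERATION».  OCCASION: the row OWNER's
(D4-J5) `RemainderCouplingHolomorphy` (an4 g61, p292106): print's «(or analytic)» ([I] p. 263 tl.25–26, p. 264 tl.25–27; mechanism
p. 266 tl.33–37 «the functions 𝐄^{(j)}, β_j are analytic functions of the effective coupling constants») typed as the route R-266 —
a scale- and history-UNIFORM holomorphic extension (ONE radius ρ, ONE sup bound M) of g_k ↦ β_{k+1}(g₀,…,g_k) ⟹ `LastVarDerivBound β (M∕ρ′) γ₀`
⟹ (AF-1) ⟹ the JUNCTION shape of (D4).  Its landing line records, by hand and by a proof-breaking mutant only (d4-p3 X51 N1 «radius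
inside ∀ k p»), that THE UNIFORM RADIUS IS THE LOAD-BEARING UNPRINTED LETTER.  This file is the MODEL crew's kernel witness of that
sentence and of its twin for the sup bound, on the cheapest possible carrier.

HONEST FRAMING (BETA-SPEC §0.2, verbatim and binding). *"Discharging BetaPertH makes Bałaban's UV stability UNCONDITIONAL — a real
constructive-QFT result; it is NOT the continuum limit and NOT the Clay problem."*  This module discharges NOTHING of the kind:
one-variable calculus and Cauchy-free norm arithmetic on a TOY family, against the tree's typed SHAPES `FlowStep.HBeta`,
`B12Beta.OneLoopSplit` ([I] (2.12)–(2.14) p. 268), `Beta.RemainderChain.RemainderConst`, `BetaDerivClause.LastVarDerivBound` and the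
(D4-J4)∕(D4-J5) shapes, used BY NAME; nothing of Bałaban's (1.22) is asserted, constructed or instantiated; row D4 class UNCHANGED
(critical-path width 0; instance 0∕1; D4 DISCHARGE NO DATE).  NOT BetaPertH, NOT continuum, NOT Clay.  HONEST DEPENDENCY: continuum
YM on T⁴ ⇐ BetaPertH ∧ nine spine estimates (0/9 proved); BetaPertH ⇐ (D1) ∧ (D4) ∧ CAP+tail; G-an2-4 gates asym, D1 and NE2/3/4.

THE WITNESS (family as hypothesis `hβ`, no definition): the MARKOV family β_{k+1}(g₀,…,g_k) = r₀·(1 − e^{−(k+1)·g_k}), r₀ > 0, with the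
printed split β⁰ ≡ 0, β¹ = β (β¹ vanishes at g_k = 0, as p. 268 requires).  It is entire in g_k, increasing, 0 ≤ β¹ < r₀ on every box,
with ∂β¹_{k+1}∕∂g_k(0) = r₀(k+1).
WHAT IS PROVED ([folklore]; 0 sorry; 0 `def`).
* §1 CURRENCIES: `expfam_remainderConst` (`RemainderConst S γ r₀` on EVERY box — R-ε₁'s exit SHAPE, as for (D4-J4)'s step family);
  `expfam_diag_exceeds` ∕ `expfam_le_of_remainderConst` (on a box `γ > 0` every remainder constant is `≥ r₀`: the constant history
  `(γ,…,γ)` at the scale `k ≈ r∕((r₀−r)γ)`; `e^{−x} ≤ 1∕(1+x)`); `expfam_remainderConst_iff` (`RemainderConst S γ r ↔ r₀ ≤ r`);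
  **`expfam_consumed_iff`** (CONSUMED(b) ⟺ r₀ < b); `expfam_junction_elim` (JUNCTION ⟹ r₀ < r₀ through (D4-J4) `consumed_of_junction`:
  the junction FAILS); `expfam_osc` ((OSC) holds exactly — the family is Markov — so the failure is (DIAG) alone, read off `expfam_diag_exceeds`).
* §2 PER-SCALE REGULARITY, AS PRINTED AND BEYOND: `expfam_contDiff` (every last-variable section is `ContDiff ℝ ⊤`, i.e. real-analytic);
  `expfam_iteratedDeriv_bounded` (for every scale and every order m, the m-th derivative is bounded on [0, γ₀] — the p. 264 tl.25–27
  clause in its per-j reading ONLY (weaker than R-264's uniform-in-j reading, the row's; precision P-an4-62-1), here a CONSEQUENCE of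
  smoothness on ℝ and compactness, carrying no constant); `expfam_hasDerivAt` ∕
  `expfam_hasDerivAt_zero` (∂β_{k+1}∕∂g_k = r₀(k+1)e^{−(k+1)g_k}, = r₀(k+1) at 0: the per-scale constants are honest and UNBOUNDED in k);
  **`expfam_holo_perScaleRadius`** ((D4-J5)'s hypothesis with the radius moved inside the scale quantifier: F_k(z) = r₀(1 − e^{−(k+1)z}) is
  entire, ‖F_k‖ ≤ r₀(1 + e) on the (1∕(k+1))-neighbourhood of [0, γ₀] — ONE M, radii → 0); **`expfam_holo_perScaleBound`** (the same F_k on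
  the ρ-neighbourhood for ANY fixed ρ: ‖F_k‖ ≤ r₀(1 + e^{(k+1)ρ}) — ONE ρ, sup bounds → ∞).
* §3 WHAT FAILS, BY NAME: `expfam_not_af1` (no (AF-1) constant on any box; else (D4-J4) `junction_of_af1`); `expfam_not_lastVarDerivBound`
  (R-264's hypothesis fails for every C; `BetaDerivClause` chain); **`expfam_not_uniformHolo`** ((D4-J5)'s hypothesis fails for every
  γ₀ > 0, ρ > 0, M and EVERY choice of extensions; else `RemainderCouplingHolomorphy.junction_of_holo`).
* END `perScale_holomorphy_not_sufficient` — for every r₀ > 0 a history family with printed split exhibiting all of the above at once.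
READING (sense (α), for CITATION-FIT §2 and the OWNER's `SUMMIT-MAP-INPUT-d4.md` §18): of the two unlettered words in [I] p. 264's
clause, «analytic» PER SCALE buys nothing towards (D4) in either shape at tolerances b ≤ r₀ — an entire, monotone, Markov family with
all derivatives bounded at every scale sits in R-ε₁'s exit shape with constant EQUAL to r₀ and has no junction; what R-266 adds to
print, the pair (ρ, M) uniform in the scale (and the history), is necessary AS A PAIR: uniform M with per-scale ρ (radii 1∕(k+1)) and
uniform ρ with per-scale M (bounds r₀(1+e^{(k+1)ρ})) are BOTH realised here.  The same family is (D4-J4)'s step witness made entire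
(CONSUMED ⇏ JUNCTION survives analyticity in g_k) and the [I]-side twin of this lineage's Erice-side per-scale witnesses (E5)
`EriceRemainderEnclosureNecessity` ∕ (E10) `…BareCouplingFails` (per-scale (3.73) ⇏ junction).  Class UNCHANGED; print's own road to
CONSUMED(b) remains R-ε₁'s smallness GIVEN THE INSTANCE ((D4-J4) `consumed_of_constBound`). -/

noncomputable section

open Metric Set Complex

namespace Summit.QuantumFields.BalabanUV.Beta.EriceRemainderEnclosureHolomorphyNecessity

open Literature.MathematicalPhysics.QuantumFieldTheory.Balaban1983to89
open Literature.MathematicalPhysics.QuantumFieldTheory.Balaban1983to89.FlowStep (HBeta)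
open Literature.MathematicalPhysics.QuantumFieldTheory.Balaban1983to89.Beta.RemainderChain (RemainderConst)
open Literature.MathematicalPhysics.QuantumFieldTheory.Balaban1983to89.BetaDerivClause
  (LastVarDerivBound lastVarLipschitz_of_derivBound atZero_of_lastVarLipschitz af1_of_atZero)
open Summit.QuantumFields.BalabanUV.Beta.RemainderConstTwoShapes
  (consumed_of_junction consumed_of_constBound junction_of_af1)
open Summit.QuantumFields.BalabanUV.Beta.RemainderCouplingHolomorphy (junction_of_holo)

/-! ## §0 An exponential inequality and the complex carrier -/
/-- For `x > 0`: `0 < 1 − e^{−x} < 1`. [folklore] -/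
theorem one_sub_exp_neg_bounds {x : ℝ} (hx : 0 < x) : 0 < 1 - Real.exp (-x) ∧ 1 - Real.exp (-x) < 1 :=
  ⟨by have := Real.exp_lt_one_iff.mpr (neg_lt_zero.mpr hx); linarith, by linarith [Real.exp_pos (-x)]⟩

/-- The complex carrier `z ↦ r₀(1 − e^{−(k+1)z})` is entire. [folklore] -/
theorem expfamC_differentiable (r₀ : ℝ) (k : ℕ) :
    Differentiable ℂ fun z : ℂ => (r₀ : ℂ) * (1 - Complex.exp (-(((k : ℂ) + 1) * z))) := by
  fun_prop

/-- On the open `ρ`-neighbourhood of a point `s ≥ 0` of the real axis: `−(k+1)·Re z ≤ (k+1)ρ`. [folklore] -/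
theorem neg_scale_re_le {k : ℕ} {z : ℂ} {s ρ : ℝ} (hs : 0 ≤ s) (hzs : dist z (s : ℂ) < ρ) :
    -(((k : ℝ) + 1) * z.re) ≤ ((k : ℝ) + 1) * ρ := by
  have h1 : |z.re - s| < ρ := by
    have h := abs_re_le_norm (z - (s : ℂ))
    rw [sub_re, ofReal_re] at h
    rw [Complex.dist_eq] at hzs
    exact h.trans_lt hzs
  have h2 : -z.re ≤ ρ := by
    have := (abs_lt.mp h1).1
    linarith
  have hk : 0 ≤ (k : ℝ) + 1 := by positivity
  calc -(((k : ℝ) + 1) * z.re) = ((k : ℝ) + 1) * (-z.re) := by ring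
    _ ≤ ((k : ℝ) + 1) * ρ := mul_le_mul_of_nonneg_left h2 hk

/-- Norm of the complex carrier from a bound on `−(k+1)·Re z`: `‖r₀(1 − e^{−(k+1)z})‖ ≤ r₀(1 + e^{B})`. [folklore] -/
theorem norm_expfamC_le {r₀ : ℝ} (hr₀ : 0 ≤ r₀) (k : ℕ) (z : ℂ) {B : ℝ} (hB : -(((k : ℝ) + 1) * z.re) ≤ B) :
    ‖(r₀ : ℂ) * (1 - Complex.exp (-(((k : ℂ) + 1) * z)))‖ ≤ r₀ * (1 + Real.exp B) := by
  have hre : (-(((k : ℂ) + 1) * z)).re = -(((k : ℝ) + 1) * z.re) := by simp [Complex.mul_re]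
  calc ‖(r₀ : ℂ) * (1 - Complex.exp (-(((k : ℂ) + 1) * z)))‖
      = r₀ * ‖(1 : ℂ) - Complex.exp (-(((k : ℂ) + 1) * z))‖ := by
        rw [norm_mul, Complex.norm_real, Real.norm_of_nonneg hr₀]
    _ ≤ r₀ * (‖(1 : ℂ)‖ + ‖Complex.exp (-(((k : ℂ) + 1) * z))‖) := mul_le_mul_of_nonneg_left (norm_sub_le _ _) hr₀
    _ = r₀ * (1 + Real.exp (-(((k : ℝ) + 1) * z.re))) := by rw [norm_one, Complex.norm_exp, hre]
    _ ≤ r₀ * (1 + Real.exp B) := by gcongr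

variable {β : HBeta}

section ExpFam

variable {r₀ : ℝ}
  (hβ : ∀ (k : ℕ) (p : Fin (k + 1) → ℝ), β k p = r₀ * (1 - Real.exp (-(((k : ℝ) + 1) * p (Fin.last k)))))
include hβ

/-! ## §1 The family in the row's currencies: RemainderConst, CONSUMED(b), (DIAG)∕(OSC), JUNCTION -/

section Split

variable (S : B12Beta.OneLoopSplit β) (hS0 : ∀ k, S.β0 k = 0)
include hS0

/-- With one-loop part `0` the remainder IS the family: `β¹_{k+1}(p) = r₀(1 − e^{−(k+1)g_k})`. [folklore] -/
theorem expfam_β1_eq (k : ℕ) (p : Fin (k + 1) → ℝ) :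
    S.β1 k p = r₀ * (1 - Real.exp (-(((k : ℝ) + 1) * p (Fin.last k)))) := by
  have h := S.split k p
  rw [hS0 k, zero_add, hβ k p] at h
  exact h.symm

/-- `0 ≤ β¹_{k+1}(p) < r₀` whenever `g_k > 0` (`r₀ > 0`). [folklore] -/
theorem expfam_β1_bounds (hr₀ : 0 < r₀) (k : ℕ) (p : Fin (k + 1) → ℝ) (hp : 0 < p (Fin.last k)) :
    0 ≤ S.β1 k p ∧ S.β1 k p < r₀ := by
  have hx : 0 < ((k : ℝ) + 1) * p (Fin.last k) := by positivity
  obtain ⟨h1, h2⟩ := one_sub_exp_neg_bounds hx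
  rw [expfam_β1_eq hβ S hS0 k p]
  refine ⟨mul_nonneg hr₀.le h1.le, ?_⟩
  calc r₀ * (1 - Real.exp (-(((k : ℝ) + 1) * p (Fin.last k)))) < r₀ * 1 := mul_lt_mul_of_pos_left h2 hr₀
    _ = r₀ := mul_one r₀

/-- **R-ε₁'s exit SHAPE at every box:** `RemainderConst S γ r₀` for EVERY γ. [folklore] -/
theorem expfam_remainderConst (hr₀ : 0 < r₀) (γ : ℝ) : RemainderConst S γ r₀ := fun k p hp => by
  obtain ⟨h0, h1⟩ := expfam_β1_bounds hβ S hS0 hr₀ k p (hp (Fin.last k)).1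
  rw [abs_of_nonneg h0]
  exact h1.le

/-- **The diagonal exceeds every `r < r₀` at a late scale:** on the constant history `(γ,…,γ)`, `γ > 0`, some scale `k` has
`r < β¹_{k+1}` (take `(k+1)γ(r₀ − r) > r` and use `x∕(1+x) ≤ 1 − e^{−x}`). [folklore] -/
theorem expfam_diag_exceeds (hr₀ : 0 < r₀) {γ : ℝ} (hγ : 0 < γ) {r : ℝ} (hr : r < r₀) :
    ∃ k : ℕ, r < S.β1 k (fun _ : Fin (k + 1) => γ) := by
  by_cases hrneg : r < 0
  · exact ⟨0, hrneg.trans_le (expfam_β1_bounds hβ S hS0 hr₀ 0 (fun _ => γ) hγ).1⟩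
  · push Not at hrneg
    have hd : 0 < (r₀ - r) * γ := mul_pos (by linarith) hγ
    obtain ⟨N, hN⟩ := exists_nat_gt (r / ((r₀ - r) * γ))
    refine ⟨N, ?_⟩
    have hNx : r < (N : ℝ) * ((r₀ - r) * γ) := (div_lt_iff₀ hd).mp hN
    have hval : S.β1 N (fun _ : Fin (N + 1) => γ) = r₀ * (1 - Real.exp (-(((N : ℝ) + 1) * γ))) := by
      rw [expfam_β1_eq hβ S hS0]
    have hx0 : 0 ≤ ((N : ℝ) + 1) * γ := by positivity
    have h1x : 0 < 1 + ((N : ℝ) + 1) * γ := by linarith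
    -- `x ∕ (1 + x) ≤ 1 − e^{−x}` for `x = (N+1)γ ≥ 0`, from `1 + x ≤ eˣ`
    have hlow : ((N : ℝ) + 1) * γ / (1 + ((N : ℝ) + 1) * γ) ≤ 1 - Real.exp (-(((N : ℝ) + 1) * γ)) := by
      have hexp : Real.exp (-(((N : ℝ) + 1) * γ)) * (1 + ((N : ℝ) + 1) * γ) ≤ 1 :=
        calc Real.exp (-(((N : ℝ) + 1) * γ)) * (1 + ((N : ℝ) + 1) * γ)
            ≤ Real.exp (-(((N : ℝ) + 1) * γ)) * Real.exp (((N : ℝ) + 1) * γ) :=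
              mul_le_mul_of_nonneg_left (by linarith [Real.add_one_le_exp (((N : ℝ) + 1) * γ)]) (Real.exp_pos _).le
          _ = 1 := by rw [← Real.exp_add, neg_add_cancel, Real.exp_zero]
      rw [div_le_iff₀ h1x]
      nlinarith [hexp]
    have hkey : r * (1 + ((N : ℝ) + 1) * γ) < r₀ * (((N : ℝ) + 1) * γ) := by nlinarith
    have hstep : r < r₀ * (((N : ℝ) + 1) * γ / (1 + ((N : ℝ) + 1) * γ)) := by
      rw [mul_div_assoc', lt_div_iff₀ h1x]
      exact hkey
    rw [hval]
    exact hstep.trans_le (mul_le_mul_of_nonneg_left hlow hr₀.le)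

/-- **Every remainder constant on a box `γ > 0` is at least `r₀`.** [folklore] -/
theorem expfam_le_of_remainderConst (hr₀ : 0 < r₀) {γ r : ℝ} (hγ : 0 < γ) (hR : RemainderConst S γ r) : r₀ ≤ r := by
  by_contra hlt
  push Not at hlt
  obtain ⟨k, hk⟩ := expfam_diag_exceeds hβ S hS0 hr₀ hγ hlt
  have hB := hR k (fun _ => γ) (fun _ => ⟨hγ, le_rfl⟩)
  exact (lt_irrefl r) (hk.trans_le ((le_abs_self _).trans hB))

/-- **`RemainderConst S γ r ↔ r₀ ≤ r`** on every box `γ > 0`. [folklore] -/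
theorem expfam_remainderConst_iff (hr₀ : 0 < r₀) {γ : ℝ} (hγ : 0 < γ) (r : ℝ) : RemainderConst S γ r ↔ r₀ ≤ r :=
  ⟨expfam_le_of_remainderConst hβ S hS0 hr₀ hγ, fun h k p hp => (expfam_remainderConst hβ S hS0 hr₀ γ k p hp).trans h⟩

/-- **CONSUMED(b) ⟺ r₀ < b** («∃ γ₀ > 0 ∃ r, 0 ≤ r ∧ r < b ∧ RemainderConst S γ₀ r», (D4-J4)'s consumed shape): binder (D4) AS
CONSUMED holds for the family exactly above the threshold r₀ — through (D4-J4) `consumed_of_constBound` with the γ-independent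
constant r₀ — and FAILS at every tolerance `b ≤ r₀`. [folklore] -/
theorem expfam_consumed_iff (hr₀ : 0 < r₀) (b : ℝ) :
    (∃ γ₀ : ℝ, 0 < γ₀ ∧ ∃ r : ℝ, 0 ≤ r ∧ r < b ∧ RemainderConst S γ₀ r) ↔ r₀ < b := by
  refine ⟨fun ⟨γ₀, hγ₀, r, _, hrb, hR⟩ => (expfam_le_of_remainderConst hβ S hS0 hr₀ hγ₀ hR).trans_lt hrb, fun hb => ?_⟩
  exact consumed_of_constBound S one_pos hr₀.le (expfam_remainderConst hβ S hS0 hr₀ 1) hb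

/-- **THE JUNCTION SHAPE FAILS** — at `b = r₀` the junction would give CONSUMED(r₀) ((D4-J4) `consumed_of_junction`), i.e. `r₀ < r₀` by
`expfam_consumed_iff`; likewise (DIAG) fails by `expfam_diag_exceeds` at `ε = r₀∕2`.  Stated as the one-line reduction it is (the bare
«¬ JUNCTION» sentence for a hypothesis-carried family is (D4-J4)'s `step_not_junction` shape; this lemma is its entire-family instance
through the CONSUMED currency). [folklore] -/
theorem expfam_junction_elim (hr₀ : 0 < r₀)
    (hJ : ∀ b : ℝ, 0 < b → ∃ γ₁ : ℝ, 0 < γ₁ ∧ ∀ γ : ℝ, 0 < γ → γ ≤ γ₁ →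
      ∃ r : ℝ, 0 ≤ r ∧ r < b ∧ RemainderConst S γ r) : r₀ < r₀ :=
  (expfam_consumed_iff hβ S hS0 hr₀ r₀).mp (consumed_of_junction S hJ hr₀)

end Split

/-- **(OSC) HOLDS EXACTLY** — the family is MARKOV: β_{k+1}(p) = β_{k+1}(g_k,…,g_k); so its junction failure is (DIAG) alone
((D4-J2) `remainderConst_small_iff_diag_and_osc`). [folklore] -/
theorem expfam_osc {ε : ℝ} (hε : 0 < ε) :
    ∃ g₀ : ℝ, 0 < g₀ ∧ ∀ (k : ℕ) (p : Fin (k + 1) → ℝ), p ∈ B12Beta.HistBox g₀ k →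
      |β k p - β k (fun _ : Fin (k + 1) => p (Fin.last k))| ≤ ε :=
  ⟨1, one_pos, fun k p _ => by rw [hβ k p, hβ k, sub_self, abs_zero]; exact hε.le⟩

/-! ## §2 Per-scale regularity: the p. 264 clause as printed (per j), and per-scale holomorphic extensions both ways -/

/-- The last-variable section at scale `k`, history `p`, IS `g ↦ r₀(1 − e^{−(k+1)g})`. [folklore] -/
theorem expfam_section_eq (k : ℕ) (p : Fin (k + 1) → ℝ) :
    (fun g : ℝ => β k (Function.update p (Fin.last k) g)) = fun g => r₀ * (1 - Real.exp (-(((k : ℝ) + 1) * g))) := by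
  funext g
  rw [hβ k, Function.update_self]

/-- **Smooth, indeed real-analytic, in the last coupling at every scale** (`ContDiff ℝ ⊤`). [folklore] -/
theorem expfam_contDiff (k : ℕ) (p : Fin (k + 1) → ℝ) :
    ContDiff ℝ ⊤ (fun g : ℝ => β k (Function.update p (Fin.last k) g)) := by
  rw [expfam_section_eq hβ k p]
  fun_prop

/-- **The p. 264 tl.25–27 clause in its PER-SCALE reading holds:** at every scale, for every history and every order `m`, the
`m`-th derivative of the last-variable section is bounded on `[0, γ₀]` — here merely because a smooth function's derivatives are
continuous and `[0, γ₀]` is compact; the bound depends on the scale (cf. `expfam_hasDerivAt_zero`).  PRECISION (the OWNER's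
P-an4-62-1): this is the per-j reading ONLY — WEAKER than R-264's uniform-in-j reading of the same printed words (`LastVarDerivBound`,
the row's reading), which FAILS for this family (`expfam_not_lastVarDerivBound`); no reader should take this theorem as print's clause
met in the row's sense. [cite: Balaban1987RG1, §1 p.264 — shape only, nothing asserted] -/
theorem expfam_iteratedDeriv_bounded (k : ℕ) (p : Fin (k + 1) → ℝ) (m : ℕ) (γ₀ : ℝ) :
    ∃ C : ℝ, ∀ g ∈ Icc (0 : ℝ) γ₀, ‖iteratedDeriv m (fun g : ℝ => β k (Function.update p (Fin.last k) g)) g‖ ≤ C := by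
  have hcont : Continuous (iteratedDeriv m (fun g : ℝ => β k (Function.update p (Fin.last k) g))) :=
    (expfam_contDiff hβ k p).continuous_iteratedDeriv m le_top
  exact isCompact_Icc.exists_bound_of_continuousOn hcont.continuousOn

/-- The derivative in the last coupling: `∂β_{k+1}∕∂g_k = r₀(k+1)e^{−(k+1)g_k}`. [folklore] -/
theorem expfam_hasDerivAt (k : ℕ) (p : Fin (k + 1) → ℝ) (g : ℝ) :
    HasDerivAt (fun g : ℝ => β k (Function.update p (Fin.last k) g))
      (r₀ * (((k : ℝ) + 1) * Real.exp (-(((k : ℝ) + 1) * g)))) g := by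
  rw [expfam_section_eq hβ k p]
  have h1 : HasDerivAt (fun g : ℝ => -(((k : ℝ) + 1) * g)) (-(((k : ℝ) + 1) * 1)) g :=
    ((hasDerivAt_id g).const_mul ((k : ℝ) + 1)).neg
  have h3 := ((h1.exp).const_sub 1).const_mul r₀
  exact h3.congr_deriv (by ring)

/-- … equal to `r₀(k+1)` at `g_k = 0`: the honest per-scale derivative constants are UNBOUNDED in the scale. [folklore] -/
theorem expfam_hasDerivAt_zero (k : ℕ) (p : Fin (k + 1) → ℝ) :
    HasDerivAt (fun g : ℝ => β k (Function.update p (Fin.last k) g)) (r₀ * ((k : ℝ) + 1)) 0 := by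
  simpa using expfam_hasDerivAt hβ k p 0

/-- **(D4-J5)'s HYPOTHESIS WITH THE RADIUS INSIDE THE SCALE QUANTIFIER HOLDS — ONE sup bound `M = r₀(1 + e)`, radii `1∕(k+1) → 0`:**
at every scale `k` and history `p`, `F_k(z) = r₀(1 − e^{−(k+1)z})` is complex-differentiable on (indeed beyond) the `1∕(k+1)`-neighbourhood
of `[0, γ₀]`, bounded there by `r₀(1+e)` (as `−(k+1)Re z ≤ 1`), and restricts to the section.  This is d4-p3 X51's mutant N1 «radius
inside ∀ k p», TRUE for this family while the junction fails (§1) — FALSE-IN-TRUTH as a route, by a witness.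
[cite: Balaban1987RG1, §2 p.266 — shape only, nothing asserted] -/
theorem expfam_holo_perScaleRadius (hr₀ : 0 ≤ r₀) (γ₀ : ℝ) (k : ℕ) (p : Fin (k + 1) → ℝ) :
    ∃ F : ℂ → ℂ,
      DifferentiableOn ℂ F {z : ℂ | ∃ s : ℝ, s ∈ Icc (0 : ℝ) γ₀ ∧ dist z (s : ℂ) < 1 / ((k : ℝ) + 1)} ∧
      (∀ z : ℂ, (∃ s : ℝ, s ∈ Icc (0 : ℝ) γ₀ ∧ dist z (s : ℂ) < 1 / ((k : ℝ) + 1)) →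
        ‖F z‖ ≤ r₀ * (1 + Real.exp 1)) ∧
      ∀ g : ℝ, g ∈ Icc (0 : ℝ) γ₀ → F (g : ℂ) = (β k (Function.update p (Fin.last k) g) : ℂ) := by
  refine ⟨fun z => (r₀ : ℂ) * (1 - Complex.exp (-(((k : ℂ) + 1) * z))), (expfamC_differentiable r₀ k).differentiableOn,
    ?_, fun g _ => ?_⟩
  · rintro z ⟨s, hs, hzs⟩
    have hk : ((k : ℝ) + 1) * (1 / ((k : ℝ) + 1)) = 1 := mul_one_div_cancel (by positivity)
    exact norm_expfamC_le hr₀ k z ((neg_scale_re_le hs.1 hzs).trans_eq hk)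
  · rw [hβ k, Function.update_self]
    push_cast
    ring_nf

/-- **(D4-J5)'s HYPOTHESIS WITH THE SUP BOUND INSIDE THE SCALE QUANTIFIER HOLDS — ONE radius `ρ`, bounds `M_k = r₀(1 + e^{(k+1)ρ}) → ∞`:**
the same `F_k` on the `ρ`-neighbourhood of `[0, γ₀]`, any `ρ`. [cite: Balaban1987RG1, §2 p.266 — shape only, nothing asserted] -/
theorem expfam_holo_perScaleBound (hr₀ : 0 ≤ r₀) (γ₀ ρ : ℝ) (k : ℕ) (p : Fin (k + 1) → ℝ) :
    ∃ F : ℂ → ℂ,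
      DifferentiableOn ℂ F {z : ℂ | ∃ s : ℝ, s ∈ Icc (0 : ℝ) γ₀ ∧ dist z (s : ℂ) < ρ} ∧
      (∀ z : ℂ, (∃ s : ℝ, s ∈ Icc (0 : ℝ) γ₀ ∧ dist z (s : ℂ) < ρ) →
        ‖F z‖ ≤ r₀ * (1 + Real.exp (((k : ℝ) + 1) * ρ))) ∧
      ∀ g : ℝ, g ∈ Icc (0 : ℝ) γ₀ → F (g : ℂ) = (β k (Function.update p (Fin.last k) g) : ℂ) := by
  refine ⟨fun z => (r₀ : ℂ) * (1 - Complex.exp (-(((k : ℂ) + 1) * z))), (expfamC_differentiable r₀ k).differentiableOn,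
    ?_, fun g _ => ?_⟩
  · rintro z ⟨s, hs, hzs⟩
    exact norm_expfamC_le hr₀ k z (neg_scale_re_le hs.1 hzs)
  · rw [hβ k, Function.update_self]
    push_cast
    ring_nf

/-! ## §3 What fails, by name: (AF-1), R-264's derivative clause, R-266's uniform holomorphy -/

section Fails

variable (S : B12Beta.OneLoopSplit β) (hS0 : ∀ k, S.β0 k = 0)
include hS0

/-- **No (AF-1) constant on any box** `]0,γ₀]^{k+1}`: else the junction by (D4-J4) `junction_of_af1`. [folklore] -/
theorem expfam_not_af1 (hr₀ : 0 < r₀) {γ₀ : ℝ} (hγ₀ : 0 < γ₀) (C : ℝ) :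
    ¬ (∀ (k : ℕ) (p : Fin (k + 1) → ℝ), p ∈ B12Beta.HistBox γ₀ k → |S.β1 k p| ≤ C * p (Fin.last k)) := by
  intro hAF1
  have hC : 0 ≤ C := by
    have h := (abs_nonneg _).trans (hAF1 0 (fun _ => γ₀) (fun _ => ⟨hγ₀, le_rfl⟩))
    by_contra hC
    push Not at hC
    linarith [mul_neg_of_neg_of_pos hC hγ₀]
  exact (lt_irrefl r₀) (expfam_junction_elim hβ S hS0 hr₀ (junction_of_af1 S hC hγ₀ hAF1))

/-- **R-264's hypothesis `LastVarDerivBound β C γ₀` FAILS for every `C`** (and every `γ₀ > 0`) — although every section is entire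
with all derivatives bounded per scale (§2): the uniformity in the scale is what fails. [cite: Balaban1987RG1, §1 p.264 — shape only,
nothing asserted] -/
theorem expfam_not_lastVarDerivBound (hr₀ : 0 < r₀) {γ₀ : ℝ} (hγ₀ : 0 < γ₀) (C : ℝ) : ¬ LastVarDerivBound β C γ₀ :=
  fun hD => expfam_not_af1 hβ S hS0 hr₀ hγ₀ C
    (af1_of_atZero S (atZero_of_lastVarLipschitz (lastVarLipschitz_of_derivBound hD)))

/-- **R-266's hypothesis — (D4-J5)'s UNIFORM (ρ, M) — FAILS for every `γ₀ > 0`, every `ρ > 0`, every `M`, and EVERY choice of the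
extensions `F`**: else the junction by `RemainderCouplingHolomorphy.junction_of_holo` (with `ρ′ = ρ∕2`; `0 ≤ M` is forced at `z = 0`).
Together with §2: the pair's uniformity is load-bearing, each half separately. [cite: Balaban1987RG1, §2 p.266 — shape only, nothing
asserted] -/
theorem expfam_not_uniformHolo (hr₀ : 0 < r₀) {γ₀ ρ : ℝ} (hγ₀ : 0 < γ₀) (hρ : 0 < ρ) (M : ℝ) :
    ¬ (∀ (k : ℕ) (p : Fin (k + 1) → ℝ), p ∈ B12Beta.HistBox γ₀ k → ∃ F : ℂ → ℂ,
      DifferentiableOn ℂ F {z : ℂ | ∃ s : ℝ, s ∈ Icc (0 : ℝ) γ₀ ∧ dist z (s : ℂ) < ρ} ∧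
      (∀ z : ℂ, (∃ s : ℝ, s ∈ Icc (0 : ℝ) γ₀ ∧ dist z (s : ℂ) < ρ) → ‖F z‖ ≤ M) ∧
      ∀ g : ℝ, g ∈ Icc (0 : ℝ) γ₀ → F (g : ℂ) = (β k (Function.update p (Fin.last k) g) : ℂ)) := by
  intro hHol
  have hM : 0 ≤ M := by
    obtain ⟨F, -, hFM, -⟩ := hHol 0 (fun _ => γ₀) (fun _ => ⟨hγ₀, le_rfl⟩)
    exact (norm_nonneg _).trans (hFM 0 ⟨0, ⟨le_rfl, hγ₀.le⟩, by simpa using hρ⟩)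
  exact (lt_irrefl r₀) (expfam_junction_elim hβ S hS0 hr₀ (junction_of_holo S hγ₀ (half_pos hρ) (half_lt_self hρ) hM hHol))

end Fails

end ExpFam

/-! ## END -/
/-- A printed split with one-loop part `0` EXISTS for the family (its value at `g_k = 0` is `0`). [folklore] -/
theorem expfam_split_exists {r₀ : ℝ}
    (hβ : ∀ (k : ℕ) (p : Fin (k + 1) → ℝ), β k p = r₀ * (1 - Real.exp (-(((k : ℝ) + 1) * p (Fin.last k))))) :
    ∃ S : B12Beta.OneLoopSplit β, ∀ k, S.β0 k = 0 :=
  ⟨⟨fun _ => 0, β, fun k p => by ring, fun k p hp => by rw [hβ k p, hp]; simp⟩, fun _ => rfl⟩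

/-- **END — PER-SCALE HOLOMORPHY (EITHER UNIFORMITY DROPPED) AND THE PER-SCALE p. 264 CLAUSE DO NOT GIVE (D4), IN EITHER SHAPE.**
For every `r₀ > 0` there are a history family `β` and a printed split `S` such that: (a) every last-variable section is `ContDiff ℝ ⊤`
and every derivative of every order is bounded on every `[0, γ₀]` (the p. 264 clause in its per-scale reading only — its
uniform-in-j reading, R-264's, fails by (g)); (b) (D4-J5)'s holomorphy hypothesis
holds with ONE sup bound and per-scale radii `1∕(k+1)`, and (c) with ONE radius `ρ` and per-scale sup bounds `r₀(1+e^{(k+1)ρ})`, for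
every `ρ`; yet (d) `RemainderConst S γ r₀` on every box and CONSUMED(b) ⟺ `r₀ < b`; (e) the JUNCTION fails; (f) (D4-J5)'s uniform
hypothesis fails for every `γ₀, ρ > 0` and `M`; (g) R-264's `LastVarDerivBound β C γ₀` fails for every `C`, `γ₀ > 0`.
[cite: Balaban1987RG1, §1 p.264 and §2 p.266 — shapes only, nothing asserted] -/
theorem perScale_holomorphy_not_sufficient {r₀ : ℝ} (hr₀ : 0 < r₀) :
    ∃ (β : HBeta) (S : B12Beta.OneLoopSplit β),
      (∀ (k : ℕ) (p : Fin (k + 1) → ℝ), ContDiff ℝ ⊤ (fun g : ℝ => β k (Function.update p (Fin.last k) g)) ∧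
        ∀ (m : ℕ) (γ₀ : ℝ), ∃ C : ℝ, ∀ g ∈ Icc (0 : ℝ) γ₀,
          ‖iteratedDeriv m (fun g : ℝ => β k (Function.update p (Fin.last k) g)) g‖ ≤ C) ∧
      (∀ (γ₀ : ℝ) (k : ℕ) (p : Fin (k + 1) → ℝ), ∃ F : ℂ → ℂ,
        DifferentiableOn ℂ F {z : ℂ | ∃ s : ℝ, s ∈ Icc (0 : ℝ) γ₀ ∧ dist z (s : ℂ) < 1 / ((k : ℝ) + 1)} ∧
        (∀ z : ℂ, (∃ s : ℝ, s ∈ Icc (0 : ℝ) γ₀ ∧ dist z (s : ℂ) < 1 / ((k : ℝ) + 1)) → ‖F z‖ ≤ r₀ * (1 + Real.exp 1)) ∧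
        ∀ g : ℝ, g ∈ Icc (0 : ℝ) γ₀ → F (g : ℂ) = (β k (Function.update p (Fin.last k) g) : ℂ)) ∧
      (∀ (γ₀ ρ : ℝ) (k : ℕ) (p : Fin (k + 1) → ℝ), ∃ F : ℂ → ℂ,
        DifferentiableOn ℂ F {z : ℂ | ∃ s : ℝ, s ∈ Icc (0 : ℝ) γ₀ ∧ dist z (s : ℂ) < ρ} ∧
        (∀ z : ℂ, (∃ s : ℝ, s ∈ Icc (0 : ℝ) γ₀ ∧ dist z (s : ℂ) < ρ) → ‖F z‖ ≤ r₀ * (1 + Real.exp (((k : ℝ) + 1) * ρ))) ∧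
        ∀ g : ℝ, g ∈ Icc (0 : ℝ) γ₀ → F (g : ℂ) = (β k (Function.update p (Fin.last k) g) : ℂ)) ∧
      (∀ γ : ℝ, RemainderConst S γ r₀) ∧
      (∀ b : ℝ, (∃ γ₀ : ℝ, 0 < γ₀ ∧ ∃ r : ℝ, 0 ≤ r ∧ r < b ∧ RemainderConst S γ₀ r) ↔ r₀ < b) ∧
      ¬ (∀ b : ℝ, 0 < b → ∃ γ₁ : ℝ, 0 < γ₁ ∧ ∀ γ : ℝ, 0 < γ → γ ≤ γ₁ →
          ∃ r : ℝ, 0 ≤ r ∧ r < b ∧ RemainderConst S γ r) ∧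
      (∀ (γ₀ ρ M : ℝ), 0 < γ₀ → 0 < ρ →
        ¬ (∀ (k : ℕ) (p : Fin (k + 1) → ℝ), p ∈ B12Beta.HistBox γ₀ k → ∃ F : ℂ → ℂ,
          DifferentiableOn ℂ F {z : ℂ | ∃ s : ℝ, s ∈ Icc (0 : ℝ) γ₀ ∧ dist z (s : ℂ) < ρ} ∧
          (∀ z : ℂ, (∃ s : ℝ, s ∈ Icc (0 : ℝ) γ₀ ∧ dist z (s : ℂ) < ρ) → ‖F z‖ ≤ M) ∧
          ∀ g : ℝ, g ∈ Icc (0 : ℝ) γ₀ → F (g : ℂ) = (β k (Function.update p (Fin.last k) g) : ℂ))) ∧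
      (∀ (γ₀ C : ℝ), 0 < γ₀ → ¬ LastVarDerivBound β C γ₀) := by
  let β : HBeta := fun k p => r₀ * (1 - Real.exp (-(((k : ℝ) + 1) * p (Fin.last k))))
  have hβ : ∀ (k : ℕ) (p : Fin (k + 1) → ℝ), β k p = r₀ * (1 - Real.exp (-(((k : ℝ) + 1) * p (Fin.last k)))) :=
    fun _ _ => rfl
  obtain ⟨S, hS0⟩ := expfam_split_exists hβ
  exact ⟨β, S, fun k p => ⟨expfam_contDiff hβ k p, fun m γ₀ => expfam_iteratedDeriv_bounded hβ k p m γ₀⟩,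
    fun γ₀ k p => expfam_holo_perScaleRadius hβ hr₀.le γ₀ k p,
    fun γ₀ ρ k p => expfam_holo_perScaleBound hβ hr₀.le γ₀ ρ k p,
    expfam_remainderConst hβ S hS0 hr₀, expfam_consumed_iff hβ S hS0 hr₀,
    fun hJ => (lt_irrefl r₀) (expfam_junction_elim hβ S hS0 hr₀ hJ),
    fun γ₀ ρ M hγ₀ hρ => expfam_not_uniformHolo hβ S hS0 hr₀ hγ₀ hρ M,
    fun γ₀ C hγ₀ => expfam_not_lastVarDerivBound hβ S hS0 hr₀ hγ₀ C⟩

end Summit.QuantumFields.BalabanUV.Beta.EriceRemainderEnclosureHolomorphyNecessity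

end
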